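import Summits.BirchSwinnertonDyer.BirchSwinnertonDyer.Theorems.QuadraticBranchSignedControlPlusEtaLowerInclusionOfMissingLowerBound
import HarnessLib

/-!
# Route `QuadraticBranchSignedControl` (rung K8, cell `bsd-potss`), residual crux
# `PlusEtaMainConjectureNonsurj` (stmt-BirchSwinnertonDyer-19606), stub `stub_etaMC_nonCM_lower`:
# on the non-CM NON-onto (`C_ns⁺(p)`) rows of analytic rank `0`, the Eisenstein stub FOLLOWS from the
# integral Kato-side stub `stub_etaMC_nonCM_upper` and the lower half of `BSD_p` of the additive partner
# — the converse road with `ρ` onto REPLACED by exactly what Kobayashi's Thm. 4.1 lacks off the onto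
# locus (seat `bsd-potss-ctrl` g4; planner g16 re-aim 18:26Z)

WHAT. The birth skeleton of 19606 (planner g14) cuts Kobayashi's even main conjecture at `η` on the
Gss2 twists `V` whose `p`-adic tower is NOT onto into: Thm. 2.2 at `η` (cite-level), the CM rows
(`stub_etaMC_cm`), and on the non-CM rows — at a good supersingular `p ≥ 5` exactly the curves with
`Im ρ̄_{V,p} = C_ns⁺(p)` (k8eta-c2, p448914; below `5·10⁵` only `p = 5`, 28 pairs) — the INTEGRAL
Kato-side inclusion `(L_p⁺(V,η,X)) ⊆ Char(X⁺(V/K_∞)^η)` (`stub_etaMC_nonCM_upper`; Kobayashi's Thm. 4.1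
gives it only up to `pⁿ` there: Kato's Thm. 12.5 (4) integrality wants `SL₂(ℤ_p) ⊆ Im ρ`, and Wuthrich
2014 pp. 398–399: "the hypothesis … that `E` is semi-stable can not be dropped. For instance, there are curves
`E/ℚ` such that `ρ̄_p` has its image in the normaliser of a non-split Cartan subgroup" — NOTHING in print)
and the Eisenstein inclusion (E⁺_η) (`stub_etaMC_nonCM_lower`, nothing in print). THIS FILE: on the rows
whose additive partner `W` (`C • W^{(p*)} = V`) has `L(W,1) ≠ 0`,

  `stub_etaMC_nonCM_upper` at `(V, p)` + `ord_p #Ш(W)_an ≤ ord_p #Ш(W)` (`Typed.MissingLowerBoundAt W p`)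
  + Thm. 2.2 at `η` + Kitajima–Otsuki 1.3 at `η` + Poitou–Tate + modularity + GZK
  ⟹ `stub_etaMC_nonCM_lower` at `(V, p)`, and hence the crux's conclusion (C1⁺_η)(V) itself

— seat ctrl g4's converse road `ConverseControl.quadraticBranchPlusEtaLowerInclusionAt_of_missingLowerBoundAt`
(whose Kato-side binder `hup` IS the upper stub's conclusion `EtaUpperIntegralAt V p`, verbatim), then
k8q-c2's bookkeeping `quadraticBranchPlusEtaMainConjectureAt_of_thm22_of_upper_of_etaLowerInclusion`.
Neither Thm. 2.2 at `η` nor Kitajima–Otsuki's Thm. 1.3 carries an image hypothesis (their named facts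
quantify over every good `a_p = 0` curve), so `ρ` onto is replaced by EXACTLY ONE binder: the integral
upper inclusion — the literature gap of these rows. So on its rank-`0` rows the residual crux 19606 is
«`stub_etaMC_nonCM_upper` + one lower-`BSD_p` witness per row» (a unit Kurihara number does NOT serve
here: Kim's theorem wants `ρ̄` onto; descent / Cassels–Tate witnesses do).

* `quadraticBranchPlusEtaMainConjectureAt_of_etaUpperIntegral_of_missingLowerBoundAt` — pair form.
* `etaMC_nonsurj_rankZeroRows_of_upper_of_lowerBSD` — the stub-shaped ∀-form on 19606's binders
  (`¬ onto`, `¬ CM` displayed and idle: the implication holds on every row).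

HONEST FRAMING (cell `bsd-potss`, run/shared/lean/pub/bsd-potss/; FULL-BSD rank ≤ 1 programme,
tranche 1b, HUMAN RULING D-0036/D-0074): BOOKKEEPING THEOREMS ONLY — no definition, no named Literature
fact, no Summits-side `def … : Prop`, no `sorry`, axioms standard. CONDITIONAL on: the integral upper
inclusion at `η` (the OPEN stub `stub_etaMC_nonCM_upper`, hypothesis position — nothing in print for
`C_ns⁺(p)` images), Poitou–Tate duality (`poitouTate_selmerStructure_duality_real ℚ`), modularity, GZK,
Kobayashi 2003 Thm. 2.2 at `η`, Kitajima–Otsuki 2018 Main Thm. 1.3 at `η` (named facts), and per row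
`L(W,1) ≠ 0` + the lower half of `BSD_p(W)` (an INPUT). Neither stub is proved by name; the crux 19606
stays OPEN (its CM rows and rank-`1` rows are not touched); nothing is booked; no label / mark / count
moves; `BSD(W, p)` is claimed for no pair. `--supports stmt-BirchSwinnertonDyer-19606`.

References: [Kobayashi2003] Thm. 2.2 (p. 5), §4 Even main conjecture + Thm. 4.1 (p. 8);
[Kato2004Asterisque] Thm. 12.5 (4); [Wuthrich2014] Cor. 19 and the remark after it (pp. 398–399),
Prop. 21; [KitajimaOtsuki2018] Main Thm. 1.3; [Miller2011LMS] Def. 1.1; [Zywina2015] (image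
`C_ns⁺(p)`; shape only).
-/

set_option autoImplicit false
set_option linter.dupNamespace false

noncomputable section

open scoped Classical

open CongruenceSubgroup Field Function NumberField IsDedekindDomain WeierstrassCurve
open Literature.NumberTheory.EllipticCurves
open Literature.NumberTheory.EllipticCurves.ModularForms
open Literature.NumberTheory.EllipticCurves.Rank1Residual
open Literature.NumberTheory.EllipticCurves.Rank1Residual.Typed
open Literature.NumberTheory.GaloisRepresentations
open Literature.NumberTheory.GaloisCohomology
open Literature.NumberTheory.EllipticCurves.IwasawaAlgebra
open Literature.NumberTheory.EllipticCurves.IwasawaDual ZpExtension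
open Summit.BirchSwinnertonDyer.Rank1Residual.X11b.Levels
open Summit.BirchSwinnertonDyer.Rank1Residual.X11b
open Summit.BirchSwinnertonDyer.Rank1Residual.Additive
open Summit.BirchSwinnertonDyer.Rank1Residual.Additive.SignedTwist
open scoped ContRepresentation
open Summit.BirchSwinnertonDyer.Rank1Residual.AdditivePotMult

namespace Summit.BirchSwinnertonDyer.BirchSwinnertonDyer.Theorems

namespace ConverseControl

variable (W : WeierstrassCurve ℚ) [W.IsElliptic] [W.IsGloballyMinimal] (p : ℕ) [hp : Fact p.Prime]

/-- **(C1⁺_η)(V) — Kobayashi's even main conjecture at `η` in full — at a Gss2 pair of analytic rank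
`0` from the INTEGRAL upper inclusion at `η` (displayed: the conclusion of 19606's stub
`stub_etaMC_nonCM_upper` at `(V,p)`, verbatim `EtaUpperIntegralAt V p`) and the LOWER half of
`BSD_p(W)`** — no image hypothesis on `ρ_{V,p}`: `⊆` is the converse road
(`quadraticBranchPlusEtaLowerInclusionAt_of_missingLowerBoundAt`), `⊇` is the displayed binder,
finiteness / torsion is Thm. 2.2 at `η`. CONDITIONAL on the displayed inputs; closes nothing.
[cite: Kobayashi2003, §4 Even main conjecture and Thm. 4.1 (p. 8), Thm. 2.2 (p. 5)]
[cite: Wuthrich2014, remark after Cor. 19 (pp. 398–399)] [cite: Miller2011LMS, Def. 1.1] -/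
theorem quadraticBranchPlusEtaMainConjectureAt_of_etaUpperIntegral_of_missingLowerBoundAt
    (hPT : poitouTate_selmerStructure_duality_real ℚ) (hmod : hasEntireLFunction_rat)
    (hGZK : rank_eq_analyticRank_of_analyticRank_le_one)
    (h22 : Kobayashi2003.thm22_etaSignedSelmerDual_finite_torsion)
    (hKO : KitajimaOtsuki2018.mainThm13_etaSignedSelmerDual_noFiniteSubmodule)
    (V : WeierstrassCurve ℚ) [V.IsElliptic] [V.IsGloballyMinimal] (C : VariableChange ℚ)
    (hp5 : 5 ≤ p) (hCV : C • W.quadraticTwist ((-1) ^ (p / 2) * p) = V)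
    (hgood : V.HasGoodReductionAtPrime p) (hap : V.frobeniusTrace p = 0)
    (hup : ∀ (K₀ : Type) [Field K₀] [NumberField K₀] [IsCyclotomicExtension {p} ℚ K₀]
        [(galRange (K := ℚ) K₀).Normal] (ηq : absoluteGaloisGroup ℚ →* ℤˣ),
        (∀ σ ∈ galRange (K := ℚ) K₀, ηq σ = 1) → ηq ≠ 1 →
      ∀ {N : ℕ} [NeZero N] {f : CuspForm (Gamma0 N) 2},
        p ≠ 2 → V.HasGoodReductionAtPrime p → V.frobeniusTrace p = 0 → IsNewformOf V f →
      ∀ (ϖ : ℚ), (if Even (p / 2) then (ϖ : ℝ) * V.realPeriodRat = plusPeriod f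
          else (ϖ : ℝ) * V.imaginaryPeriodRat = minusPeriod f) →
      ∀ (Lη : IwasawaAlgebra p), IsQuadraticBranchPlusLFunction f p ϖ Lη →
      ∀ (κ : ZpExtension ℚ p) (γ : absoluteGaloisGroup ℚ),
        κ.IsCyclotomic → κ.IsTopGenerator γ → γ ∈ galRange (K := ℚ) K₀ → IsCyclotomicVariable p γ →
      ∀ (D : EtaSignedSelmerDualData V κ K₀ ℚ_[p] ηq γ 1), Ideal.span {Lη} ≤ D.charIdeal)
    (hLW : W.entireLFunction 1 ≠ 0) (hlow : MissingLowerBoundAt W p) :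
    QuadraticBranchPlusEtaMainConjectureAt V p :=
  quadraticBranchPlusEtaMainConjectureAt_of_thm22_of_upper_of_etaLowerInclusion h22 hup
    (quadraticBranchPlusEtaLowerInclusionAt_of_missingLowerBoundAt W p hPT hmod hGZK h22 hKO V C hp5 hCV
      hgood hap hup hLW hlow)

end ConverseControl

/-- **19606 on its analytic-rank-`0` rows = `stub_etaMC_nonCM_upper` + one lower-`BSD_p` witness per
row.** On the binders of the registered stubs of crux `PlusEtaMainConjectureNonsurj` (`p ≥ 5`, `V` good
with `a_p = 0`, tower NOT onto, `V` non-CM — the last two DISPLAYED and idle): the conclusion of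
`stub_etaMC_nonCM_upper` at `(V,p)` (`EtaUpperIntegralAt V p`, verbatim) together with an additive
partner `W` (`C • W^{(p*)} = V`, globally minimal) with `L(W,1) ≠ 0` and `ord_p #Ш(W)_an ≤ ord_p #Ш(W)`
gives the crux's conclusion `QuadraticBranchPlusEtaMainConjectureAt V p` (in particular
`stub_etaMC_nonCM_lower`'s conclusion, `quadraticBranchPlusEtaLowerInclusionAt_of_plusEtaMainConjectureAt`),
granted Poitou–Tate, modularity, GZK, Thm. 2.2 at `η` and Kitajima–Otsuki at `η` (named facts — none
of them with an image hypothesis). The onto hypothesis of Kobayashi's Thm. 4.1 is replaced by exactly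
ONE binder, the integral upper inclusion: the literature gap of the `C_ns⁺(p)` rows (Wuthrich 2014
pp. 398–399). CONDITIONAL; neither stub is proved by name; the rank-`1` and CM rows are not touched.
[cite: Kobayashi2003, §4 and Thm. 4.1 (p. 8)] [cite: Wuthrich2014, remark after Cor. 19 (pp. 398–399)]
[cite: Kato2004Asterisque, Thm. 12.5 (4)] -/
theorem etaMC_nonsurj_rankZeroRows_of_upper_of_lowerBSD
    (hPT : poitouTate_selmerStructure_duality_real ℚ) (hmod : hasEntireLFunction_rat)
    (hGZK : rank_eq_analyticRank_of_analyticRank_le_one)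
    (h22 : Kobayashi2003.thm22_etaSignedSelmerDual_finite_torsion)
    (hKO : KitajimaOtsuki2018.mainThm13_etaSignedSelmerDual_noFiniteSubmodule) :
    ∀ (V : WeierstrassCurve ℚ) [V.IsElliptic] [V.IsGloballyMinimal] (p : ℕ) [Fact p.Prime],
      5 ≤ p → V.HasGoodReductionAtPrime p → V.frobeniusTrace p = 0 →
      ¬ (∀ m : ℕ, V.HasSurjectiveModNGaloisRep (p ^ m : ℕ)) → ¬ V.HasCM →
      (∀ (K₀ : Type) [Field K₀] [NumberField K₀] [IsCyclotomicExtension {p} ℚ K₀]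
          [(galRange (K := ℚ) K₀).Normal] (ηq : absoluteGaloisGroup ℚ →* ℤˣ),
          (∀ σ ∈ galRange (K := ℚ) K₀, ηq σ = 1) → ηq ≠ 1 →
        ∀ {N : ℕ} [NeZero N] {f : CuspForm (Gamma0 N) 2},
          p ≠ 2 → V.HasGoodReductionAtPrime p → V.frobeniusTrace p = 0 → IsNewformOf V f →
        ∀ (ϖ : ℚ), (if Even (p / 2) then (ϖ : ℝ) * V.realPeriodRat = plusPeriod f
            else (ϖ : ℝ) * V.imaginaryPeriodRat = minusPeriod f) →
        ∀ (Lη : IwasawaAlgebra p), IsQuadraticBranchPlusLFunction f p ϖ Lη →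
        ∀ (κ : ZpExtension ℚ p) (γ : absoluteGaloisGroup ℚ),
          κ.IsCyclotomic → κ.IsTopGenerator γ → γ ∈ galRange (K := ℚ) K₀ → IsCyclotomicVariable p γ →
        ∀ (D : EtaSignedSelmerDualData V κ K₀ ℚ_[p] ηq γ 1), Ideal.span {Lη} ≤ D.charIdeal) →
      (∃ (W : WeierstrassCurve ℚ) (_ : W.IsElliptic) (_ : W.IsGloballyMinimal) (C : VariableChange ℚ),
          C • W.quadraticTwist ((-1) ^ (p / 2) * p) = V ∧ W.entireLFunction 1 ≠ 0 ∧
            MissingLowerBoundAt W p) →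
        QuadraticBranchPlusEtaMainConjectureAt V p := by
  intro V _ _ p _ hp5 hgood hap _ _ hup hW
  obtain ⟨W, _, _, C, hCV, hLW, hlow⟩ := hW
  exact ConverseControl.quadraticBranchPlusEtaMainConjectureAt_of_etaUpperIntegral_of_missingLowerBoundAt
    W p hPT hmod hGZK h22 hKO V C hp5 hCV hgood hap hup hLW hlow

end Summit.BirchSwinnertonDyer.BirchSwinnertonDyer.Theorems

end
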